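import Mathlib

/-!
# Discrete uncertainty (Heisenberg) inequality on a chain (kernel #232, lemmaR-A3 §8(r)/(u), PLAN §113)

Solo-blind programme, session s90.  In regime (II) of LEMMA R⁺ the INNER-zone resolvent bounds for
the scaled streak block `i(z - J_ss)/s₁ ≈ -i∂² + y² + i√2 x` are proved for `x ≥ -1/2` by the
numerical-range argument: `|⟨((L + ζ) u, u)⟩| ≥ (‖u'‖² + ‖y u‖²)/√2 ≥ ‖u‖²/√2`, whose last step is the
uncertainty inequality `‖u‖² ≤ 2 ‖y u‖ ‖u'‖`.  This file proves the DISCRETE version used on the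
chain itself (no continuum limit needed): for `u : ℕ → ℂ` with `u 0 = 0` and `u N = 0`,

  `∑_{m<N} ‖u m‖² ≤ 2 · √(∑_{m<N} m² ‖u m‖²) · √(∑_{m<N} ‖u (m+1) - u m‖²)`.

Proof: Abel summation `∑_{m<N} ((m+1)‖u(m+1)‖² - m‖u m‖²) = N ‖u N‖² = 0`, the elementary bound
`|‖a‖² - ‖b‖²| ≤ ‖a - b‖ (‖a‖ + ‖b‖)`, and Cauchy–Schwarz.
-/

namespace Summit.AnomalousDissipation.AnomalousDissipation.Theorems

open Finset

/-- `|‖a‖² - ‖b‖²| ≤ ‖a - b‖ (‖a‖ + ‖b‖)` in any normed group (here `ℂ`). -/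
theorem discreteUncertainty_abs_sq_sub_sq_le (a b : ℂ) :
    |‖a‖ ^ 2 - ‖b‖ ^ 2| ≤ ‖a - b‖ * (‖a‖ + ‖b‖) := by
  have h1 : ‖a‖ ^ 2 - ‖b‖ ^ 2 = (‖a‖ - ‖b‖) * (‖a‖ + ‖b‖) := by ring
  rw [h1, abs_mul, abs_of_nonneg (by positivity : (0:ℝ) ≤ ‖a‖ + ‖b‖)]
  exact mul_le_mul_of_nonneg_right (abs_norm_sub_norm_le a b) (by positivity)

/-- Abel / telescoping identity: `∑_{m<N} ((m+1) f(m+1) - m f m) = N f N`. -/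
theorem discreteUncertainty_telescope (f : ℕ → ℝ) (N : ℕ) :
    ∑ m ∈ range N, (((m:ℝ) + 1) * f (m + 1) - (m:ℝ) * f m) = (N:ℝ) * f N := by
  have := Finset.sum_range_sub (fun m => (m:ℝ) * f m) N
  simpa [Nat.cast_succ] using this

/-- Shift of the plain sum under the boundary conditions `u 0 = 0`, `u N = 0`:
`∑_{m<N} ‖u(m+1)‖² = ∑_{m<N} ‖u m‖²`. -/
theorem discreteUncertainty_shift (u : ℕ → ℂ) (N : ℕ) (h0 : u 0 = 0) (hN : u N = 0) :
    ∑ m ∈ range N, ‖u (m + 1)‖ ^ 2 = ∑ m ∈ range N, ‖u m‖ ^ 2 := by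
  have h := Finset.sum_range_succ_comm (fun m => ‖u m‖ ^ 2) N
  -- ∑_{m<N+1} ‖u m‖² = ‖u N‖² + ∑_{m<N} ‖u m‖²  and  = ‖u 0‖² + ∑_{m<N} ‖u(m+1)‖²
  have h2 := Finset.sum_range_succ' (fun m => ‖u m‖ ^ 2) N
  rw [Finset.sum_range_succ] at h2
  simp [h0, hN] at h2
  linarith

/-- DISCRETE UNCERTAINTY INEQUALITY.  For `u : ℕ → ℂ` vanishing at `0` and at `N`,
`∑_{m<N} ‖u m‖² ≤ 2 √(∑_{m<N} m² ‖u m‖²) √(∑_{m<N} ‖u(m+1) - u m‖²)`. -/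
theorem discrete_uncertainty (u : ℕ → ℂ) (N : ℕ) (h0 : u 0 = 0) (hN : u N = 0) :
    ∑ m ∈ range N, ‖u m‖ ^ 2 ≤
      2 * Real.sqrt (∑ m ∈ range N, (m:ℝ) ^ 2 * ‖u m‖ ^ 2) *
        Real.sqrt (∑ m ∈ range N, ‖u (m + 1) - u m‖ ^ 2) := by
  -- Step 1: ∑ ‖u m‖² = ∑ ‖u(m+1)‖² = -∑ m (‖u(m+1)‖² - ‖u m‖²)
  have hshift := discreteUncertainty_shift u N h0 hN
  have htel := discreteUncertainty_telescope (fun m => ‖u m‖ ^ 2) N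
  simp only [hN, norm_zero] at htel
  have hkey : ∑ m ∈ range N, ‖u m‖ ^ 2 =
      - ∑ m ∈ range N, (m:ℝ) * (‖u (m + 1)‖ ^ 2 - ‖u m‖ ^ 2) := by
    have : ∑ m ∈ range N, (((m:ℝ) + 1) * ‖u (m + 1)‖ ^ 2 - (m:ℝ) * ‖u m‖ ^ 2)
        = ∑ m ∈ range N, ‖u (m + 1)‖ ^ 2 + ∑ m ∈ range N, (m:ℝ) * (‖u (m + 1)‖ ^ 2 - ‖u m‖ ^ 2) := by
      rw [← Finset.sum_add_distrib]; apply Finset.sum_congr rfl; intro m _; ring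
    have hz : ((N:ℝ)) * (0:ℝ) ^ 2 = 0 := by ring
    rw [this, hz] at htel
    linarith
  -- Step 2: pointwise bound m |‖u(m+1)‖² - ‖u m‖²| ≤ ‖Δ_m‖ · (m (‖u(m+1)‖ + ‖u m‖))
  have hpt : ∀ m ∈ range N, -((m:ℝ) * (‖u (m + 1)‖ ^ 2 - ‖u m‖ ^ 2)) ≤
      ‖u (m + 1) - u m‖ * ((m:ℝ) * (‖u (m + 1)‖ + ‖u m‖)) := by
    intro m _
    have hm : (0:ℝ) ≤ m := Nat.cast_nonneg m
    have hab := discreteUncertainty_abs_sq_sub_sq_le (u (m + 1)) (u m)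
    have := neg_abs_le (‖u (m + 1)‖ ^ 2 - ‖u m‖ ^ 2)
    nlinarith [hab, this, norm_nonneg (u (m + 1) - u m), norm_nonneg (u (m+1)), norm_nonneg (u m)]
  have hS : ∑ m ∈ range N, ‖u m‖ ^ 2 ≤
      ∑ m ∈ range N, ‖u (m + 1) - u m‖ * ((m:ℝ) * (‖u (m + 1)‖ + ‖u m‖)) := by
    rw [hkey, ← Finset.sum_neg_distrib]
    exact Finset.sum_le_sum hpt
  -- Step 3: Cauchy–Schwarz  (∑ f g)² ≤ (∑ f²)(∑ g²)
  have hCS : (∑ m ∈ range N, ‖u (m + 1) - u m‖ * ((m:ℝ) * (‖u (m + 1)‖ + ‖u m‖))) ^ 2 ≤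
      (∑ m ∈ range N, ‖u (m + 1) - u m‖ ^ 2) *
        ∑ m ∈ range N, ((m:ℝ) * (‖u (m + 1)‖ + ‖u m‖)) ^ 2 :=
    Finset.sum_mul_sq_le_sq_mul_sq _ _ _
  -- Step 4: ∑ m² (‖a‖+‖b‖)² ≤ 4 ∑ m² ‖u m‖²   (using m² ≤ (m+1)² and the shift with u N = 0)
  have hW : ∑ m ∈ range N, ((m:ℝ) * (‖u (m + 1)‖ + ‖u m‖)) ^ 2 ≤
      4 * ∑ m ∈ range N, (m:ℝ) ^ 2 * ‖u m‖ ^ 2 := by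
    have h1 : ∀ m ∈ range N, ((m:ℝ) * (‖u (m + 1)‖ + ‖u m‖)) ^ 2 ≤
        2 * (((m:ℝ) + 1) ^ 2 * ‖u (m + 1)‖ ^ 2) + 2 * ((m:ℝ) ^ 2 * ‖u m‖ ^ 2) := by
      intro m _
      have hm : (0:ℝ) ≤ m := Nat.cast_nonneg m
      nlinarith [norm_nonneg (u (m+1)), norm_nonneg (u m), sq_nonneg (‖u (m + 1)‖ - ‖u m‖),
        mul_nonneg hm (norm_nonneg (u (m+1))), sq_nonneg ((m:ℝ) * ‖u (m+1)‖)]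
    have h2 := Finset.sum_le_sum h1
    have h3 : ∑ m ∈ range N, (((m:ℝ) + 1) ^ 2 * ‖u (m + 1)‖ ^ 2) ≤ ∑ m ∈ range N, (m:ℝ) ^ 2 * ‖u m‖ ^ 2 := by
      -- shift: ∑_{m<N} (m+1)² ‖u(m+1)‖² = ∑_{m<N+1} m² ‖u m‖² - 0 = ∑_{m<N} m²‖u m‖² + N²‖u N‖²
      have e := Finset.sum_range_succ' (fun m => (m:ℝ) ^ 2 * ‖u m‖ ^ 2) N
      rw [Finset.sum_range_succ] at e
      simp [hN, Nat.cast_succ] at e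
      linarith
    calc ∑ m ∈ range N, ((m:ℝ) * (‖u (m + 1)‖ + ‖u m‖)) ^ 2
        ≤ ∑ m ∈ range N, (2 * (((m:ℝ) + 1) ^ 2 * ‖u (m + 1)‖ ^ 2) + 2 * ((m:ℝ) ^ 2 * ‖u m‖ ^ 2)) := h2
      _ = 2 * ∑ m ∈ range N, (((m:ℝ) + 1) ^ 2 * ‖u (m + 1)‖ ^ 2) + 2 * ∑ m ∈ range N, (m:ℝ) ^ 2 * ‖u m‖ ^ 2 := by
          rw [Finset.sum_add_distrib, Finset.mul_sum, Finset.mul_sum]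
      _ ≤ 4 * ∑ m ∈ range N, (m:ℝ) ^ 2 * ‖u m‖ ^ 2 := by linarith
  -- Step 5: assemble with square roots
  set A := ∑ m ∈ range N, ‖u m‖ ^ 2 with hA
  set D := ∑ m ∈ range N, ‖u (m + 1) - u m‖ ^ 2 with hD
  set M := ∑ m ∈ range N, (m:ℝ) ^ 2 * ‖u m‖ ^ 2 with hM
  set S := ∑ m ∈ range N, ‖u (m + 1) - u m‖ * ((m:ℝ) * (‖u (m + 1)‖ + ‖u m‖)) with hSdef
  have hDnn : 0 ≤ D := Finset.sum_nonneg (fun m _ => by positivity)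
  have hMnn : 0 ≤ M := Finset.sum_nonneg (fun m _ => by positivity)
  have hS2 : S ^ 2 ≤ D * (4 * M) := le_trans hCS (mul_le_mul_of_nonneg_left hW hDnn)
  have hSnn : 0 ≤ S := le_trans (Finset.sum_nonneg (fun m _ => by positivity)) hS
  have : S ≤ 2 * Real.sqrt M * Real.sqrt D := by
    have h4 : (2 * Real.sqrt M * Real.sqrt D) ^ 2 = D * (4 * M) := by
      rw [mul_pow, mul_pow, Real.sq_sqrt hMnn, Real.sq_sqrt hDnn]; ring
    have hnn : 0 ≤ 2 * Real.sqrt M * Real.sqrt D := by positivity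
    nlinarith [hS2, h4, hSnn, hnn, sq_nonneg (S - 2 * Real.sqrt M * Real.sqrt D)]
  exact le_trans hS this

end Summit.AnomalousDissipation.AnomalousDissipation.Theorems
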